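import Literature.AlgebraicGeometry.GroupSchemes.UnitComponentReductionKernel
import Literature.AlgebraicGeometry.Morphisms.FiniteFlatResiduePointLiftsToSection
import Literature.RingTheory.Valuation.AlgHomIntoValuationSubring
import HarnessLib

/-!
# The reduction sequence of a finite flat group scheme over the valuation ring of an algebraically closed field, in SECTION currency:
# `G(Ω) = G(V) ↠ G(κ̄)` with kernel `G⁰(V)` ([SerreTate1968] §1 Lemma 1; [Tate1997FiniteFlatGroupSchemes] (3.7))

Topic `Literature/AlgebraicGeometry/GroupSchemes`, namespace `Literature.AlgebraicGeometry.GroupSchemes.UnitComponent`.  THEOREMS ONLY (no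
definition, no named fact, no instance, no notation, no `sorry`).  The (b1-iii) PACKAGE of LEAD M-1a for the HEART's `canonicalLine` constructor (cell
`pub/hodgecm-mathlib`, P6 «MOD», organ sub-line `Cruxes/HLiu418/Lines/F0_P6b_ConnectedEtale.lean`; desk word F0P6b-plan (g0) 14:06:21Z (C) «YES … in section
currency `𝟙_ ⟶ G`»): for `V ⊆ Ω` a valuation subring and `G → Spec V` finite, the three clauses of «`G(Ω) = G(V) → G(κ(V))` is surjective with kernel
`G⁰(V)`» stated on SECTIONS `s : 𝟙_ (Over (Spec V)) ⟶ G`: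
* §1 **`existsUnique_section_comp_eq`** — `G(Ω) = G(V)`: every `Ω`-point `t : Spec Ω → G` over `Spec V` is `Spec Ω → Spec V → G` for a UNIQUE section
  (any valuation subring; `G` finite: its coordinate ring is integral over `V`, and `V` is integrally closed in `Ω` — ★
  `ValuationSubring.exists_algHom_equiv_algHom`, [StacksProject] Tag 052K; points dictionary ★ `Morphisms/AffinePointsOverSpec`, Tag 01I1);
* §2 **`exists_section_factor_iff_reduction_eq_unit`** — KERNEL: over a henselian local base `R` with unit component `j : G₀ ↪ G` (a homomorphism which is
  an open and closed immersion with connected source), a section `s` factors through `G₀` iff its reduction `Spec κ(R) → Spec R → G` is the unit `κ(R)`-point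
  (★ `exists_factor_iff_reduction_eq_unit` at `f = id`, [Tate1997FiniteFlatGroupSchemes] (3.7));
* §3 SURJECTIVITY is ★ `Literature.AlgebraicGeometry.Morphisms.exists_section_residue_comp_eq` (`Morphisms/FiniteFlatResiduePointLiftsToSection`, `G` finite
  FLAT, `Ω` algebraically closed) — already in section currency; cited BY NAME, not restated (the gate's `dedup.landed`).
Generic capital `--supports stmt-HodgeConjecture-24832`.  HONEST LABEL: HC_CM is proved only modulo the cell's 2 remaining named inputs (hLiu418 24832, h413 24833)
until rung 0 closes; this file pays no letter.

## References
* [SerreTate1968] J.-P. Serre, J. Tate, *Good reduction of abelian varieties*, Ann. of Math. 88 (1968), §1 Lemma 1 (the reduction map on points of a finite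
  flat group scheme over a strictly henselian ring).
* [Tate1997FiniteFlatGroupSchemes] J. Tate, *Finite flat group schemes*, in: Modular Forms and Fermat's Last Theorem (1997), (3.7).
* [StacksProject] The Stacks Project, Tag 052K (valuation rings are integrally closed ∕ maps from integral algebras), Tag 01I1 (points of affine schemes),
  Tag 04GG.
-/

set_option autoImplicit false

noncomputable section

universe u

open CategoryTheory AlgebraicGeometry IsLocalRing MonoidalCategory CartesianMonoidalCategory
open scoped MonObj

namespace Literature.AlgebraicGeometry.GroupSchemes.UnitComponent

/-! ### §1 `G(Ω) = G(V)`: `Ω`-points of a finite `V`-scheme are sections, uniquely -/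

/-- **`G(Ω) = G(V)` for `G` finite over a valuation subring `V ⊆ Ω`.**  Every `t : Spec Ω → G` over `Spec V` factors as `Spec Ω → Spec V → G` through a
UNIQUE section `s : 𝟙_ ⟶ G`: the ring map `Γ(G, 𝒪) → Ω` of `t` takes values in `V` (`Γ(G, 𝒪)` is module-finite, hence integral, over `V`, and `V` is
integrally closed in `Ω`, ★ `ValuationSubring.exists_algHom_equiv_algHom`), and `V → Ω` is injective.  [cite: StacksProject, Tag 052K]
[cite: StacksProject, Tag 01I1] [cite: SerreTate1968, §1 Lemma 1] -/
theorem existsUnique_section_comp_eq {Ω : Type u} [Field Ω] (V : ValuationSubring Ω) (G : Over (Spec (CommRingCat.of V))) [IsFinite G.hom]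
    (t : Spec (CommRingCat.of Ω) ⟶ G.left) (ht : t ≫ G.hom = Spec.map (CommRingCat.ofHom (algebraMap V Ω))) :
    ∃! s : 𝟙_ (Over (Spec (CommRingCat.of V))) ⟶ G, Spec.map (CommRingCat.ofHom (algebraMap V Ω)) ≫ s.left = t := by
  haveI : IsAffine G.left := isAffine_of_isAffineHom G.hom
  set φ : CommRingCat.of (↥V) ⟶ Γ(G.left, ⊤) := (Scheme.ΓSpecIso (.of ↥V)).inv ≫ G.hom.appTop with hφ
  letI : Algebra (↥V) Γ(G.left, ⊤) := φ.hom.toAlgebra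
  haveI : Module.Finite (↥V) Γ(G.left, ⊤) := finite_structureRingHom G
  haveI : Algebra.IsIntegral (↥V) Γ(G.left, ⊤) := Algebra.IsIntegral.of_finite _ _
  -- charts of points over `Spec V` are ring maps under `V`
  have chart : ∀ {S : CommRingCat.{u}} (g : CommRingCat.of ↥V ⟶ S) (z : Spec S ⟶ G.left), z ≫ G.hom = Spec.map g →
      (z.appTop ≫ (Scheme.ΓSpecIso S).hom).hom.comp (algebraMap (↥V) Γ(G.left, ⊤)) = g.hom := by
    intro S g z hz
    have h := (Literature.AlgebraicGeometry.Morphisms.comp_eq_specMap_iff G.hom g z).mp hz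
    have h' := congrArg CommRingCat.Hom.hom h
    simp only [CommRingCat.hom_comp] at h'
    rw [RingHom.algebraMap_toAlgebra, hφ, CommRingCat.hom_comp]
    exact h'
  -- the `Ω`-point as a `V`-algebra map, and its `V`-valued form
  let χ : Γ(G.left, ⊤) →ₐ[↥V] Ω :=
    AlgHom.mk (t.appTop ≫ (Scheme.ΓSpecIso (.of Ω)).hom).hom fun r => RingHom.congr_fun (chart _ t ht) r
  obtain ⟨e, he⟩ := V.exists_algHom_equiv_algHom (C := Γ(G.left, ⊤))
  set ψ : Γ(G.left, ⊤) →ₐ[↥V] ↥V := e.symm χ with hψ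
  have hψχ : ∀ c, ((ψ c : ↥V) : Ω) = χ c := fun c => by rw [← he ψ c, hψ, Equiv.apply_symm_apply]
  -- the section
  let s₀ : Spec (CommRingCat.of ↥V) ⟶ G.left := Spec.map (CommRingCat.ofHom ψ.toRingHom) ≫ G.left.isoSpec.inv
  have hs₀chart : s₀.appTop ≫ (Scheme.ΓSpecIso (.of ↥V)).hom = CommRingCat.ofHom ψ.toRingHom :=
    Literature.AlgebraicGeometry.Morphisms.appTop_specMap_comp_isoSpec_inv_comp_ΓSpecIso_hom _
  have hs₀ : s₀ ≫ G.hom = 𝟙 (Spec (CommRingCat.of ↥V)) := by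
    rw [← Spec.map_id]
    refine (Literature.AlgebraicGeometry.Morphisms.comp_eq_specMap_iff G.hom (𝟙 (CommRingCat.of ↥V)) s₀).mpr ?_
    rw [hs₀chart]
    apply CommRingCat.hom_ext
    exact RingHom.ext fun r => ψ.commutes r
  -- charts of `Spec Ω → Spec V → G` for a `V`-point `u`
  have chartΩ : ∀ u : Spec (CommRingCat.of ↥V) ⟶ G.left,
      (Spec.map (CommRingCat.ofHom (algebraMap (↥V) Ω)) ≫ u).appTop ≫ (Scheme.ΓSpecIso (.of Ω)).hom =
        (u.appTop ≫ (Scheme.ΓSpecIso (.of ↥V)).hom) ≫ CommRingCat.ofHom (algebraMap (↥V) Ω) := by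
    intro u
    conv_lhs => rw [← Literature.AlgebraicGeometry.Morphisms.specMap_appTop_comp_ΓSpecIso_hom_comp_isoSpec_inv u, ← Category.assoc,
      ← Spec.map_comp]
    exact Literature.AlgebraicGeometry.Morphisms.appTop_specMap_comp_isoSpec_inv_comp_ΓSpecIso_hom _
  refine ⟨Over.homMk s₀ hs₀, ?_, fun s' hs' => ?_⟩
  · -- existence: the charts of `Spec Ω → Spec V →s G` and of `t` agree
    change Spec.map (CommRingCat.ofHom (algebraMap (↥V) Ω)) ≫ s₀ = t
    apply Literature.AlgebraicGeometry.Morphisms.bijective_appTop_comp_ΓSpecIso_hom.1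
    change (Spec.map (CommRingCat.ofHom (algebraMap (↥V) Ω)) ≫ s₀).appTop ≫ _ = t.appTop ≫ _
    rw [chartΩ s₀, hs₀chart]
    apply CommRingCat.hom_ext
    exact RingHom.ext fun c => hψχ c
  · -- uniqueness: `V → Ω` is injective, so the chart of `s′` is determined by that of `t`
    apply Over.OverMorphism.ext
    change s'.left = s₀
    apply Literature.AlgebraicGeometry.Morphisms.bijective_appTop_comp_ΓSpecIso_hom.1
    change s'.left.appTop ≫ _ = s₀.appTop ≫ _
    rw [hs₀chart]
    apply CommRingCat.hom_ext
    refine RingHom.ext fun c => IsFractionRing.injective (↥V) Ω ?_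
    have h1 := congrArg (fun k : Spec (CommRingCat.of Ω) ⟶ G.left => (k.appTop ≫ (Scheme.ΓSpecIso (.of Ω)).hom).hom c) hs'
    simp only [chartΩ s'.left, CommRingCat.hom_comp, CommRingCat.hom_ofHom, RingHom.comp_apply] at h1
    exact h1.trans (hψχ c).symm

/-! ### §2 The kernel of reduction on sections is the unit component -/

/-- **KERNEL of reduction on sections.**  `R` henselian local, `G → Spec R` a finite group scheme, `j : G₀ ⟶ G` a homomorphism which is an open and
closed immersion with `G₀` connected (the unit component).  A section `s : 𝟙_ ⟶ G` factors through `G₀` iff its reduction `Spec κ(R) → Spec R → G` is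
the unit `κ(R)`-point (★ `exists_factor_iff_reduction_eq_unit` at `R′ = R`, `f = id`). [cite: Tate1997FiniteFlatGroupSchemes, (3.7)]
[cite: SerreTate1968, §1 Lemma 1] -/
theorem exists_section_factor_iff_reduction_eq_unit (R : Type u) [CommRing R] [HenselianLocalRing R] (G G₀ : Over (Spec (CommRingCat.of R)))
    [GrpObj G] [GrpObj G₀] (j : G₀ ⟶ G) [IsMonHom j] [IsOpenImmersion j.left] [IsClosedImmersion j.left] [ConnectedSpace G₀.left]
    [IsFinite G.hom] (s : 𝟙_ (Over (Spec (CommRingCat.of R))) ⟶ G) :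
    (∃ s₀ : 𝟙_ (Over (Spec (CommRingCat.of R))) ⟶ G₀, s₀ ≫ j = s) ↔
      Spec.map (CommRingCat.ofHom (residue R)) ≫ s.left =
        Spec.map (CommRingCat.ofHom (residue R)) ≫ (η[G] : 𝟙_ _ ⟶ G).left := by
  have hs : s.left ≫ G.hom = Spec.map (CommRingCat.ofHom (RingHom.id R)) := by
    rw [CommRingCat.ofHom_id, Spec.map_id]; exact Over.w s
  have key := exists_factor_iff_reduction_eq_unit R G G₀ j R (RingHom.id R) s.left hs
  rw [RingHom.comp_id] at key
  refine Iff.trans ⟨?_, ?_⟩ key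
  · rintro ⟨s₀, rfl⟩
    exact ⟨s₀.left, rfl⟩
  · rintro ⟨s', hs'⟩
    have w : s' ≫ G₀.hom = (𝟙_ (Over (Spec (CommRingCat.of R)))).hom := by
      rw [← Over.w j, ← Category.assoc, hs']; exact Over.w s
    exact ⟨Over.homMk s' w, Over.OverMorphism.ext hs'⟩

/-! ### §3 Surjectivity of reduction on sections: ★ `Literature.AlgebraicGeometry.Morphisms.exists_section_residue_comp_eq`
(`Morphisms/FiniteFlatResiduePointLiftsToSection`, already in section currency — cite it BY NAME; not restated here, `dedup.landed`). -/

end Literature.AlgebraicGeometry.GroupSchemes.UnitComponent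

end
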